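import Summits.QuantumFields.BalabanUV.T4Continuum.Support.B13AvgCorrStokes
import Literature.MathematicalPhysics.QuantumFieldTheory.Balaban1983to89.BlockAveragingTwoLevel

/-!
# B13AvgCorrStokesLoop — row NE5, κ-DISCHARGE programme (T4-DAG §8 Q49 (a′), dagwriter l.23165; design note
# `HOME/t4/b2b-balaban-t4-ne5-p1/g39/KAPPA-NE5-DESIGN.md` §3), leaf κ-L1 «FINEST STOKES», file 2∕2: THE HOLONOMY OF A (0.4) LOOP WORD IS
# WITHIN `(L′·|n|₁ + |n|₁²∕2) · s` OF `1` WHEN EVERY PLAQUETTE VARIABLE IS WITHIN `s` OF `1`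

Cell `pub-balaban`, unit `b2b-balaban-t4-ne5-formalise-leaf-01` (NE5 formalisation swarm LEAF PROVER 01, gen 22; leaf κ-L1 of the
owner's κ leaf cut, journal CLAIM l.23453).  Summits-side NEW WORK under the LEAN PLACEMENT RULE: a [folklore] group-valued lattice
Stokes bound on OUR torus walk objects (`T4Continuum.walk` ∕ `holAt`, the staircase and loop words `stairWord` ∕ `loopWord` of
`BlockAveraging`), assembled from the swap ∕ cancellation calculus of file 1∕2 `B13AvgCorrStokes`; 0 `def`, no `Prop`-valued fact
minted, nothing printed asserted, no citation tag.  HONEST FRAMING: rung (B)+1 of the FINITE-VOLUME T⁴ programme — NOT infinite volume,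
NOT a mass gap, NOT the Clay problem, NOT a proof of NE5 (NOT PRINTED; GAPS G-t4-U3-1); nothing of [Balaban1985Averaging] ∕
[Balaban1987RG1] is instantiated or discharged here.  HONEST DEPENDENCY (cell, verbatim): continuum YM on T⁴ ⇐ BetaPertH ∧ nine spine
estimates (0/9 proved); BetaPertH ⇐ (D1) ∧ (D4) ∧ CAP+tail; G-an2-4 gates asym, D1 and NE2/3/4.

Throughout, `s ≥ 0` bounds the ORDERED-PAIR plaquette variables `U⟨y,μ⟩ U⟨y+e_μ,ν⟩ U⟨y+e_ν,μ⟩⁻¹ U⟨y,ν⟩⁻¹` (`μ ≠ ν`; file 1 §3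
converts a `plaqHol` bound into this shape).
* §1 staircases and the loop words of (0.4) (`stairRuns_append` is `BlockAveragingTwoLevel`'s): `length_stairRuns`, `length_stairWord` (`= Σ_ν |n_ν|`),
  `length_stairWord_le` (`≤ d·h` when `|n_ν| ≤ h`); `two_mul_dist1_holAt_stairRuns_perm` (two staircases through the same runs in
  permuted order: `2·defect ≤ |Γ|²·s` — the first run of one is moved to the front of the other past `≤ |Γ′|` letters, then
  induction), `two_mul_dist1_holAt_stairWord`; **`dist1_holAt_loopWord_le`**: for EVERY base site `x`, length `L′`, axis `μ`,
  offset `n`, orderings `σ, σ′`, `dist1 (holAt U (walk x (loopWord L′ μ n σ σ′))) ≤ (L′·|n|₁ + |n|₁²∕2)·s`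
  (`|n|₁ = (stairWord σ n).length`) — `L′·|n|₁` swaps carry `(−c)` past `(−Γ^{σ′})` next to `[x,x′]`, where the two straight runs
  cancel (`holAt_walk_cancel_runs`), and the two staircases then differ by `≤ |n|₁²∕2` swaps; with `|n_ν| ≤ h`:
  `≤ (L′·d·h + (d·h)²∕2)·s` (`dist1_holAt_loopWord_le_of_bound`); at a coarse bond, for the loop variables of (0.4) themselves
  (`|n_ν| ≤ (L−1)∕2`, runs of `L`): **`dist1_loopHol_le`** `dist1 (loopHol U c i) ≤ (d∕2 + d²∕8)·L²·s`.  The statement is uniform in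
  the base site, the level `j`, the volume and `L′`.
* the refined loop words of a higher averaging step are again loop words (`loopWord (L^{i+1}) μ (L^i·n) σ σ′`; κ-L3's
  `B13AvgCorrRefine.refineWord_loopWord`, not repeated here), so `dist1_holAt_loopWord_le_of_bound` is applied there verbatim.
0 sorry; axioms ⊆ {propext, Classical.choice, Quot.sound}.
-/

noncomputable section

namespace Summit.QuantumFields.BalabanUV.T4Continuum.B13AvgCorrStokesLoop

open Literature.MathematicalPhysics.QuantumFieldTheory.Balaban1983to89
open Literature.MathematicalPhysics.QuantumFieldTheory.Balaban1983to89.T4Continuum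
open Literature.MathematicalPhysics.QuantumFieldTheory.Balaban1983to89.B15.PrelimIntegrations (dist1_fluct_le)
open Summit.QuantumFields.BalabanUV.T4Continuum.B13AvgCorrStokes

variable {P : Params} {j : ℕ} {G : Type*} [GaugeGroup G]

/-! ## §1 Staircases through the same runs, and the loop words of (0.4) -/

section Stairs

/-- [folklore] a run of `|k|` letters has length `|k|`. -/
theorem length_axisRun {d : ℕ} (μ : Fin d) (k : ℤ) : (axisRun μ k).length = k.natAbs := by
  simp [axisRun]

/-- [folklore] the length of a staircase is the sum of the lengths of its runs. -/
theorem length_stairRuns {d : ℕ} (n : Fin d → ℤ) : ∀ as : List (Fin d),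
    (stairRuns n as).length = (as.map fun a => (n a).natAbs).sum
  | [] => by simp [stairRuns]
  | a :: as => by simp [stairRuns, length_axisRun, length_stairRuns n as]

/-- [folklore] `|Γ^σ_{y, y+n}| = Σ_ν |n_ν|`, for every ordering `σ`. -/
theorem length_stairWord {d : ℕ} (σ : Equiv.Perm (Fin d)) (n : Fin d → ℤ) :
    (stairWord σ n).length = ∑ ν, (n ν).natAbs := by
  rw [stairWord, length_stairRuns, List.map_map, ← Fin.sum_univ_def]
  exact Equiv.sum_comp σ (fun ν => (n ν).natAbs)

/-- [folklore] the reverse word has the same length. -/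
theorem length_wordRev {d : ℕ} (w : List (Letter d)) : (wordRev w).length = w.length := by
  simp [wordRev]

/-- [folklore] bounded offsets: `|n_ν| ≤ h` for all `ν` gives `|Γ^σ| ≤ d·h`. -/
theorem length_stairWord_le {d : ℕ} (σ : Equiv.Perm (Fin d)) (n : Fin d → ℤ) {h : ℕ} (hn : ∀ ν, (n ν).natAbs ≤ h) :
    (stairWord σ n).length ≤ d * h := by
  rw [length_stairWord]
  calc ∑ ν, (n ν).natAbs ≤ ∑ _ν : Fin d, h := Finset.sum_le_sum fun ν _ => hn ν
    _ = d * h := by simp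

variable (U : GaugeField P j G) {s : ℝ} (hs0 : 0 ≤ s)
  (hs : ∀ (y : Site P j) (μ ν : Fin P.d), μ ≠ ν →
    dist1 (U ⟨y, μ⟩ * U ⟨y.shift μ, ν⟩ * (U ⟨y.shift ν, μ⟩)⁻¹ * (U ⟨y, ν⟩)⁻¹) ≤ s)

include hs0 hs in
/-- [folklore] **TWO STAIRCASES THROUGH THE SAME RUNS IN PERMUTED ORDER** differ in holonomy by at most `|Γ|²∕2` plaquettes: moving
the run of the first axis of `as` to the front of the other staircase costs `|n_a|·(runs before it) ≤ |n_a|·|Γ′|`, then induction. -/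
theorem two_mul_dist1_holAt_stairRuns_perm (n : Fin P.d → ℤ) : ∀ (as bs : List (Fin P.d)), as.Perm bs → ∀ x : Site P j,
    2 * dist1 (holAt U (walk x (stairRuns n as)) * (holAt U (walk x (stairRuns n bs)))⁻¹)
      ≤ ((stairRuns n as).length : ℝ) ^ 2 * s
  | [], bs, h, x => by
    have hbs : bs = [] := h.symm.eq_nil
    subst hbs
    simp [stairRuns, walk, holAt_nil, GaugeGroup.dist1_one]
  | a :: as, bs, h, x => by
    obtain ⟨bs₁, bs₂, rfl⟩ := List.append_of_mem (h.subset List.mem_cons_self)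
    have h' : as.Perm (bs₁ ++ bs₂) := (h.trans List.perm_middle).cons_inv
    have eA : stairRuns n (a :: as) = axisRun a (n a) ++ stairRuns n as := rfl
    have eB : stairRuns n (bs₁ ++ a :: bs₂) = stairRuns n bs₁ ++ (axisRun a (n a) ++ stairRuns n bs₂) := by
      rw [stairRuns_append]; rfl
    -- step 1: the common first run is free, then the induction hypothesis
    have h1 : 2 * dist1 (holAt U (walk x (axisRun a (n a) ++ stairRuns n as)) *
        (holAt U (walk x (axisRun a (n a) ++ stairRuns n (bs₁ ++ bs₂))))⁻¹) ≤ ((stairRuns n as).length : ℝ) ^ 2 * s := by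
      rw [dist1_holAt_prefix]
      exact two_mul_dist1_holAt_stairRuns_perm n as (bs₁ ++ bs₂) h' _
    -- step 2: the run of `a` moved to the front past the runs of `bs₁`
    have h2 : dist1 (holAt U (walk x (axisRun a (n a) ++ stairRuns n (bs₁ ++ bs₂))) *
        (holAt U (walk x (stairRuns n bs₁ ++ (axisRun a (n a) ++ stairRuns n bs₂))))⁻¹)
          ≤ (axisRun a (n a)).length * (stairRuns n bs₁).length * s := by
      have := dist1_holAt_block_past U hs0 hs x (stairRuns n bs₁) (axisRun a (n a)) [] (stairRuns n bs₂)
      simpa [stairRuns_append] using this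
    have hlen : ((stairRuns n bs₁).length : ℝ) ≤ (stairRuns n as).length := by
      have e : (stairRuns n as).length = (stairRuns n (bs₁ ++ bs₂)).length := by
        rw [length_stairRuns, length_stairRuns]; exact (h'.map _).sum_eq
      rw [e, stairRuns_append, List.length_append]; exact_mod_cast Nat.le_add_right _ _
    have htri := dist1_fluct_le (holAt U (walk x (axisRun a (n a) ++ stairRuns n as)))
      (holAt U (walk x (axisRun a (n a) ++ stairRuns n (bs₁ ++ bs₂))))
      (holAt U (walk x (stairRuns n bs₁ ++ (axisRun a (n a) ++ stairRuns n bs₂))))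
    rw [eA, eB, List.length_append, length_axisRun, Nat.cast_add]
    rw [length_axisRun] at h2
    have hp : (0 : ℝ) ≤ ((n a).natAbs : ℝ) := Nat.cast_nonneg _
    have hq : (0 : ℝ) ≤ ((stairRuns n as).length : ℝ) := Nat.cast_nonneg _
    nlinarith [mul_nonneg (mul_nonneg hp hs0) (sub_nonneg.2 hlen), mul_nonneg (mul_nonneg hp hp) hs0]

include hs0 hs in
/-- [folklore] `Γ^σ` and `Γ^{σ′}` between the same points: `2·dist1 (hol Γ^σ · (hol Γ^{σ′})⁻¹) ≤ |Γ|²·s`. -/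
theorem two_mul_dist1_holAt_stairWord (n : Fin P.d → ℤ) (σ σ' : Equiv.Perm (Fin P.d)) (x : Site P j) :
    2 * dist1 (holAt U (walk x (stairWord σ n)) * (holAt U (walk x (stairWord σ' n)))⁻¹)
      ≤ ((stairWord σ n).length : ℝ) ^ 2 * s :=
  two_mul_dist1_holAt_stairRuns_perm U hs0 hs n _ _
    ((Equiv.Perm.map_finRange_perm σ).trans (Equiv.Perm.map_finRange_perm σ').symm) x

include hs0 hs in
/-- [folklore] **NON-ABELIAN STOKES FOR THE LOOP WORDS OF (0.4)** `Γ^σ ++ [x,x′] ++ (−Γ^{σ′}) ++ (−c)`, read from ANY base site on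
ANY level: `dist1 (hol) ≤ (L′·|Γ| + |Γ|²∕2)·s` — `L′·|Γ|` swaps carry `(−c)` past `(−Γ^{σ′})` next to `[x,x′]`, where the two straight
runs cancel, and the two staircases then differ by `≤ |Γ|²∕2` swaps. -/
theorem dist1_holAt_loopWord_le (x : Site P j) (L' : ℕ) (μ : Fin P.d) (n : Fin P.d → ℤ)
    (σ σ' : Equiv.Perm (Fin P.d)) :
    dist1 (holAt U (walk x (loopWord L' μ n σ σ')))
      ≤ ((L' : ℝ) * (stairWord σ n).length + ((stairWord σ n).length : ℝ) ^ 2 / 2) * s := by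
  set S := stairWord σ n with hS
  set S' := stairWord σ' n with hS'
  set Pl := List.replicate L' ((μ, true) : Letter P.d) with hPl
  set Mi := List.replicate L' ((μ, false) : Letter P.d) with hMi
  have e0 : loopWord L' μ n σ σ' = (S ++ Pl) ++ (wordRev S' ++ (Mi ++ [])) := by
    simp [loopWord, hS, hS', hPl, hMi, List.append_assoc]
  -- step 1: `(−c)` past `(−Γ′)`
  have h1 := dist1_holAt_block_past U hs0 hs x Mi (wordRev S') (S ++ Pl) []
  -- step 2: `[x,x′] (−c)` cancels
  have h2 : holAt U (walk x ((S ++ Pl) ++ (Mi ++ (wordRev S' ++ [])))) = holAt U (walk x (S ++ wordRev S')) := by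
    have := holAt_walk_cancel_runs U x ((μ, true) : Letter P.d) L' S (wordRev S')
    simpa [hPl, hMi, List.append_assoc, Letter.flip] using this
  -- step 3: `Γ^σ (−Γ^{σ′})` is the quotient of the two staircases
  have hend : walkEnd x S' = walkEnd x S := by
    funext ν; rw [walkEnd_apply, walkEnd_apply, hS, hS', netDisp_stairWord, netDisp_stairWord]
  have h3 : holAt U (walk x (S ++ wordRev S')) = holAt U (walk x S) * (holAt U (walk x S'))⁻¹ := by
    rw [walk_append, holAt_append, ← hend, holAt_walk_wordRev]
  have h4 := two_mul_dist1_holAt_stairWord U hs0 hs n σ σ' x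
  have hR : ((wordRev S').length : ℝ) = (S.length : ℝ) := by
    rw [length_wordRev, hS, hS', length_stairWord, length_stairWord]
  have hM : (Mi.length : ℝ) = L' := by rw [hMi, List.length_replicate]
  rw [hR, hM] at h1
  rw [e0]
  refine (dist1_le_dist1_mul_inv_add _ (holAt U (walk x ((S ++ Pl) ++ (Mi ++ (wordRev S' ++ [])))))).trans ?_
  rw [h2, h3]
  rw [h2, h3] at h1
  rw [← hS, ← hS'] at h4
  have e : ((L' : ℝ) * S.length + (S.length : ℝ) ^ 2 / 2) * s
      = (S.length : ℝ) * L' * s + ((S.length : ℝ) ^ 2 * s) / 2 := by ring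
  rw [e]
  linarith [h1, h4]

include hs0 hs in
/-- [folklore] the same with bounded offsets `|n_ν| ≤ h`: `dist1 (hol) ≤ (L′·d·h + (d·h)²∕2)·s`. -/
theorem dist1_holAt_loopWord_le_of_bound (x : Site P j) (L' : ℕ) (μ : Fin P.d) (n : Fin P.d → ℤ)
    (σ σ' : Equiv.Perm (Fin P.d)) {h : ℕ} (hn : ∀ ν, (n ν).natAbs ≤ h) :
    dist1 (holAt U (walk x (loopWord L' μ n σ σ')))
      ≤ ((L' : ℝ) * (P.d * h) + ((P.d : ℝ) * h) ^ 2 / 2) * s := by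
  refine (dist1_holAt_loopWord_le U hs0 hs x L' μ n σ σ').trans (mul_le_mul_of_nonneg_right ?_ hs0)
  have hN : ((stairWord σ n).length : ℝ) ≤ P.d * h := by exact_mod_cast length_stairWord_le σ n hn
  have hN0 : (0 : ℝ) ≤ (stairWord σ n).length := Nat.cast_nonneg _
  have hL : (0 : ℝ) ≤ L' := Nat.cast_nonneg _
  nlinarith [mul_le_mul_of_nonneg_left hN hL, mul_le_mul hN hN hN0 (hN0.trans hN)]

include hs0 hs in
/-- [folklore] **THE LOOP VARIABLES OF (0.4) AT A COARSE BOND** (`|n_ν| ≤ (L−1)∕2`, straight runs of `L`):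
`dist1 (loopHol U c i) ≤ (d∕2 + d²∕8)·L²·s` for every `c` and every index `i = (r, σ, σ′)`. -/
theorem dist1_loopHol_le (c : PBond P (j + 1)) (i : BlockAveraging.Idx P) :
    dist1 (BlockAveraging.loopHol U c i) ≤ ((P.d : ℝ) / 2 + (P.d : ℝ) ^ 2 / 8) * (P.L : ℝ) ^ 2 * s := by
  have hh : ∀ ν, (BlockAveraging.off i.1 ν).natAbs ≤ (P.L - 1) / 2 := fun ν => by
    have hb := BlockAveraging.off_bounds i.1 ν
    have : ((BlockAveraging.off i.1 ν).natAbs : ℤ) ≤ (((P.L - 1) / 2 : ℕ) : ℤ) := by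
      rw [Int.natCast_natAbs]; exact abs_le.2 hb
    exact_mod_cast this
  refine (dist1_holAt_loopWord_le_of_bound U hs0 hs (emb c.src) P.L c.dir (BlockAveraging.off i.1) i.2.1 i.2.2 hh).trans
    (mul_le_mul_of_nonneg_right ?_ hs0)
  have hL1 : 1 ≤ P.L := P.L_pos
  have h2 : (2 : ℝ) * (((P.L - 1) / 2 : ℕ) : ℝ) ≤ P.L := by
    have : 2 * ((P.L - 1) / 2) ≤ P.L := by omega
    exact_mod_cast this
  have hd : (0 : ℝ) ≤ P.d := Nat.cast_nonneg _
  have hL : (0 : ℝ) ≤ P.L := Nat.cast_nonneg _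
  have hh0 : (0 : ℝ) ≤ (((P.L - 1) / 2 : ℕ) : ℝ) := Nat.cast_nonneg _
  nlinarith [mul_le_mul_of_nonneg_left h2 (mul_nonneg hd hL), mul_le_mul h2 h2 (by positivity) hL,
    mul_nonneg hd hd]

end Stairs

end Summit.QuantumFields.BalabanUV.T4Continuum.B13AvgCorrStokesLoop

end
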